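import Summits.AtomisticToContinuum.Crystallization.Theorems.FrustratedLawDichotomyStrainedPatchTaylorLattice
import Summits.AtomisticToContinuum.Crystallization.Theorems.FrustratedLawDichotomyFarFieldSharp

/-!
# (T2-bent₁) PROVED: the hcp neighbour count, `#instRim ≤ 167`, and the instance rim mass `≤ 167/14 ≤ 38/3` (lens-5 g53, crux 27623 T-side, node T2-bent₁)

§1 ★★ `fourteen_le_card_ball_hcp`: for an hcp instance (`Set.range z₀ =` the two hexagonal families through `G`, the second shifted by `G (hcpShift + ξ)`),
a rim site `b` (`7/4 < |z₁ b − z₁ c₁| ≤ 9/5`) with label `L_b = (β, a_b)` has the `14` distinct labels `{L_b, (false, 0)} ∪ hcpNbrs L_b` (six in its own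
family, six in the other: `nnShift` above an unshifted site, `nnShiftNeg` above a shifted one), all of norm `≤ 11/5 + 25/16 ≤ 4`, hence sites of
the instance, with bent images within `(11/10)·(25/16) = 1.71875 < 9/5` of `z₁ b`; `L_b ≠ (false, 0)` and `(false, 0) ∉ hcpNbrs L_b` because a site at
bent distance `> 7/4` cannot have offset norm `≤ 25/16`.
§2 ★★ `fourteen_le_card_ball : CompFamily1 M₁ z₁ c₁ → b ∈ instRim z₁ c₁ → 14 ≤ #B_{z₁}(b)` (fcc half from `…TaylorLattice`); ★ `card_instRim_le : #instRim ≤ 167`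
(the images are `7/10`-separated points of the shell `7/4 ≤ r ≤ 9/5`: `card_le_of_separated_shell_three` gives `≤ (43/7)³ − 4³ < 168`);
★★★ `instanceRimMass_le : Σ_{b ∈ instRim} 1/#B(b) ≤ 167/14 ≤ 38/3`, i.e. `instanceRimMassLe_holds : InstanceRimMassLe (38/3)`, and therefore
★★★ `taylorTwoBent1_holds : TaylorTwoBent1` — the piece (T2-bent₁) `SmoothTaylorTwo CompFamily1 tau1 delta0 G0 w0 rho0` of the tree split
`…StrainedPatchTaylorSplit` is PROVED with no residual hypothesis (chain A `…TaylorPair` … H `…TaylorCap`, I `…TaylorLattice`, J this file).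
-/

open scoped BigOperators Classical
open Summit.AtomisticToContinuum.Crystallization.Theorems.FrustratedLawDichotomyRangeCut (Sep)
open Summit.AtomisticToContinuum.Crystallization.Theorems.FrustratedLawDichotomyMotifLemmas
open Summit.AtomisticToContinuum.Crystallization.Theorems.FrustratedLawDichotomyAveragingCut
open Summit.AtomisticToContinuum.Crystallization.Theorems.FrustratedLawDichotomyAveragingRuleCap
open Summit.AtomisticToContinuum.Crystallization.Theorems.FrustratedLawDichotomyAveragingRuleTightFree
open Summit.AtomisticToContinuum.Crystallization.Theorems.FrustratedLawDichotomyExemptAbsorptionRecord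
open Summit.AtomisticToContinuum.Crystallization.Theorems.FrustratedLawDichotomySchurCut
open Literature.MathematicalPhysics.StatisticalMechanics (lennardJones lennardJones_nonpos)
open Summit.AtomisticToContinuum.Crystallization.Theorems.FrustratedLawDichotomyRuleToolkitGood
open Summit.AtomisticToContinuum.Crystallization.Theorems.FrustratedLawDichotomyStrainedPatchHomSplit
open Summit.AtomisticToContinuum.Crystallization.Theorems.FrustratedLawDichotomyStrainedPatchHomTermCalculus
open Summit.AtomisticToContinuum.Crystallization.Theorems.FrustratedLawDichotomyStrainedPatchChartFamilies
open Summit.AtomisticToContinuum.Crystallization.Theorems.FrustratedLawDichotomyStrainedPatchChartFamiliesBent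
open Summit.AtomisticToContinuum.Crystallization.Theorems.FrustratedLawDichotomyStrainedPatchChartFamiliesPinned
open Summit.AtomisticToContinuum.Crystallization.Theorems.FrustratedLawDichotomyStrainedPatchEnvelopeLaw
open Summit.AtomisticToContinuum.Crystallization.Theorems.FrustratedLawDichotomyStrainedPatchEnvelopeTaylor

open Summit.AtomisticToContinuum.Crystallization.Theorems.FrustratedLawDichotomyStrainedPatchTaylorSplit
open Summit.AtomisticToContinuum.Crystallization.Theorems.FrustratedLawDichotomyStrainedPatchTaylorPair
open Summit.AtomisticToContinuum.Crystallization.Theorems.FrustratedLawDichotomyStrainedPatchTaylorChord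

open Summit.AtomisticToContinuum.Crystallization.Theorems.FrustratedLawDichotomyStrainedPatchTaylorLeaves

open Summit.AtomisticToContinuum.Crystallization.Theorems.FrustratedLawDichotomyStrainedPatchTaylorRegular
open Summit.AtomisticToContinuum.Crystallization.Theorems.FrustratedLawDichotomyStrainedPatchTaylorKbandKit
open Summit.AtomisticToContinuum.Crystallization.Theorems.FrustratedLawDichotomyStrainedPatchTaylorKband
open Summit.AtomisticToContinuum.Crystallization.Theorems.FrustratedLawDichotomyStrainedPatchTaylorTail
open Summit.AtomisticToContinuum.Crystallization.Theorems.FrustratedLawDichotomyStrainedPatchTaylorKband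
open Summit.AtomisticToContinuum.Crystallization.Theorems.FrustratedLawDichotomyStrainedPatchTaylorTail
open Summit.AtomisticToContinuum.Crystallization.Theorems.FrustratedLawDichotomyStrainedPatchTaylorCap
open Literature.Barriers.AtomisticToContinuum.FlatleyTheil2015 (fccVec fccPoint norm_fccPoint_sq fccPoint_injective)
open Summit.AtomisticToContinuum.Crystallization.Theorems.FrustratedLawDichotomyStrainedPatchHomLattice (latPt_add latPt_sub latPt_neg)
open Summit.AtomisticToContinuum.Crystallization.Theorems.FrustratedLawDichotomyStrainedPatchHomRelief (latPt_fccVec_eq)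
open Summit.AtomisticToContinuum.Crystallization.Theorems.FrustratedLawDichotomyStrainedPatchHomLatticeBox
open Summit.AtomisticToContinuum.Crystallization.Theorems.FrustratedLawDichotomyStrainedPatchHomLatticeBoxHcp
open Summit.AtomisticToContinuum.Crystallization.Theorems.FrustratedLawDichotomyFarFieldSharp (card_le_of_separated_shell_three)
open Summit.AtomisticToContinuum.Crystallization.Theorems.FrustratedLawDichotomyStrainedPatchTaylorLattice

namespace Summit.AtomisticToContinuum.Crystallization.Theorems.FrustratedLawDichotomyStrainedPatchTaylorClose

open Summit.AtomisticToContinuum.Crystallization.Theorems.FrustratedLawDichotomyStrainedPatchRecutBuild (polyBend_zero)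

/-! ## §1. hcp instances: a rim site has at least `14` instance sites within `9/5` -/

/-- ★★ hcp instances: a site `b` with `7/4 < |z₁ b − z₁ c₁| ≤ 9/5` has `≥ 14` instance sites within `9/5`: itself, the centre, six in its
own layer family and six in the other (offsets `≤ 25/16`, bent chords `≤ (11/10)·25/16 < 9/5`). [folklore] -/
theorem fourteen_le_card_ball_hcp {M₁ : ℕ} {z₁ z₀ : Fin M₁ → E3} {c₁ : Fin M₁} {bm : E3 → E3} (hbm : bm ∈ bends1)
    (hz : ∀ a, z₁ a - z₁ c₁ = bm (z₀ a - z₀ c₁)) {G : E3 →L[ℝ] E3} (hG : ‖G - 1‖ ≤ 1 / 4) {ξ : E3} (hξ : ‖ξ‖ ≤ 1 / 4)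
    (hrange : Set.range z₀ = {x | dist x (z₀ c₁) ≤ 133 / 10 ∧ ∃ a : Fin 3 → ℤ,
      x = z₀ c₁ + latPt G hexFrame a ∨ x = z₀ c₁ + latPt G hexFrame a + G (hcpShift + ξ)})
    {b : Fin M₁} (hb1 : 7 / 4 < dist (z₁ b) (z₁ c₁)) (hb2 : dist (z₁ b) (z₁ c₁) ≤ 9 / 5) : 14 ≤ (ball (9 / 5) z₁ b).card := by
  classical
  have hbmem : z₀ b ∈ Set.range z₀ := ⟨b, rfl⟩
  rw [hrange] at hbmem
  obtain ⟨hbR, ab, hab⟩ := hbmem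
  obtain ⟨Lb, hLb⟩ : ∃ L : Bool × (Fin 3 → ℤ), z₀ b = z₀ c₁ + hcpPos G ξ L := by
    rcases hab with h | h
    · exact ⟨(false, ab), by rw [h]; simp [hcpPos]⟩
    · exact ⟨(true, ab), by rw [h]; simp only [hcpPos, if_true]; abel⟩
  have h0pos : hcpPos G ξ (false, 0) = 0 := by simp [hcpPos, latPt_zero]
  have hy0 : z₀ b - z₀ c₁ = hcpPos G ξ Lb := by rw [hLb]; abel
  have hyR : ‖hcpPos G ξ Lb‖ ≤ 133 / 10 := by rw [← hy0, ← dist_eq_norm]; exact hbR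
  have hzb : z₁ b - z₁ c₁ = bm (hcpPos G ξ Lb) := by rw [hz b, hy0]
  have hby : ‖bm (hcpPos G ξ Lb)‖ ≤ 9 / 5 := by rw [← hzb, ← dist_eq_norm]; exact hb2
  have hby' : 7 / 4 < ‖bm (hcpPos G ξ Lb)‖ := by rw [← hzb, ← dist_eq_norm]; exact hb1
  have hy : ‖hcpPos G ξ Lb‖ ≤ 11 / 5 := norm_le_of_bend_le hbm hyR hby
  have hposR : ∀ L : Bool × (Fin 3 → ℤ), ‖hcpPos G ξ L‖ ≤ 133 / 10 → z₀ c₁ + hcpPos G ξ L ∈ Set.range z₀ := by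
    rintro ⟨β, a⟩ h
    rw [hrange]
    refine ⟨by rw [dist_eq_norm, add_sub_cancel_left]; exact h, a, ?_⟩
    cases β
    · left; simp [hcpPos]
    · right; simp only [hcpPos, if_true]; abel
  have hfar : ¬ ‖hcpPos G ξ Lb‖ ≤ 25 / 16 := by
    intro h
    have h2 : ‖bm (hcpPos G ξ Lb) - bm 0‖ ≤ 11 / 10 * ‖hcpPos G ξ Lb - 0‖ :=
      bend_dist_le hbm (by linarith) (by rw [norm_zero]; norm_num)
    rw [polyBend_zero hbm, sub_zero, sub_zero] at h2
    linarith
  have hLb0 : Lb ≠ (false, 0) := by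
    intro h; rw [h, h0pos, polyBend_zero hbm, norm_zero] at hby'; norm_num at hby'
  have hLbN : Lb ∉ hcpNbrs Lb := by
    intro h
    rcases Finset.mem_union.1 h with h | h
    · obtain ⟨m, hm, hmL⟩ := Finset.mem_image.1 h
      have hm0 : m = 0 := by simpa using (Prod.mk.inj hmL).2
      exact card_nn6.2.1 (hm0 ▸ hm)
    · obtain ⟨m, -, hmL⟩ := Finset.mem_image.1 h
      have h1 := (Prod.mk.inj hmL).1
      revert h1; cases Lb.1 <;> decide
  have h0N : ((false, 0) : Bool × (Fin 3 → ℤ)) ∉ hcpNbrs Lb := by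
    intro h
    have := norm_hcpPos_sub_le hG hξ Lb h
    rw [h0pos, zero_sub, norm_neg] at this
    exact hfar this
  have hscard : (insert Lb (insert ((false, 0) : Bool × (Fin 3 → ℤ)) (hcpNbrs Lb))).card = 14 := by
    rw [Finset.card_insert_of_notMem, Finset.card_insert_of_notMem h0N, card_hcpNbrs]
    rw [Finset.mem_insert, not_or]; exact ⟨hLb0, hLbN⟩
  have hnorm : ∀ L ∈ insert Lb (insert ((false, 0) : Bool × (Fin 3 → ℤ)) (hcpNbrs Lb)), ‖hcpPos G ξ L‖ ≤ 4 := by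
    intro L hL
    rcases Finset.mem_insert.1 hL with rfl | hL'
    · linarith
    rcases Finset.mem_insert.1 hL' with rfl | hL''
    · rw [h0pos, norm_zero]; norm_num
    · have h1 := norm_hcpPos_sub_le hG hξ Lb hL''
      have h2 := norm_le_insert' (hcpPos G ξ L) (hcpPos G ξ Lb)
      linarith
  rw [← hscard]
  refine card_le_card_ball_of_labels _ (fun L => z₀ c₁ + hcpPos G ξ L) (fun L hL => hposR L (by linarith [hnorm L hL])) ?_ ?_
  · intro L _ L' _ h
    beta_reduce at h
    exact hcpPos_injective hG hξ (add_left_cancel h)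
  · intro L hL j hj
    have hzj : z₁ j - z₁ c₁ = bm (hcpPos G ξ L) := by rw [hz j, hj, add_sub_cancel_left]
    have hd : dist (z₁ j) (z₁ b) = ‖bm (hcpPos G ξ L) - bm (hcpPos G ξ Lb)‖ := by
      rw [dist_eq_norm, ← hzj, ← hzb]; congr 1; abel
    rw [hd]
    have hlip := bend_dist_le hbm (hnorm L hL) (by linarith : ‖hcpPos G ξ Lb‖ ≤ 4)
    rcases Finset.mem_insert.1 hL with rfl | hL'
    · rw [sub_self, norm_zero]; norm_num
    rcases Finset.mem_insert.1 hL' with rfl | hL''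
    · rw [h0pos, polyBend_zero hbm, zero_sub, norm_neg]; exact hby
    · have := norm_hcpPos_sub_le hG hξ Lb hL''
      linarith

/-! ## §2. Assembly: `#B(b) ≥ 14` on the rim, `#instRim ≤ 167`, hence the instance rim mass is `≤ 167/14 ≤ 38/3` -/

/-- ★★ Every rim site of a `𝓘₁⁺` instance has at least `14` instance sites within `9/5`. [folklore] -/
theorem fourteen_le_card_ball {M₁ : ℕ} {z₁ : Fin M₁ → E3} {c₁ : Fin M₁} (hI : CompFamily1 M₁ z₁ c₁) {b : Fin M₁} (hb : b ∈ instRim z₁ c₁) :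
    14 ≤ (ball (9 / 5) z₁ b).card := by
  have hbent : IsBentBall bends1 (133 / 10) z₁ c₁ := hI.2.2.2.1
  obtain ⟨bm, z₀, hbm, ⟨G, ξ, hG, hξ, hrange⟩, hz⟩ := hbent
  obtain ⟨hbB, hb1⟩ := Finset.mem_filter.1 hb
  have hb2 : dist (z₁ b) (z₁ c₁) ≤ 9 / 5 := mem_ball.1 hbB
  rcases hrange with h | h
  · exact fourteen_le_card_ball_fcc hbm hz hG h hb1 hb2
  · exact fourteen_le_card_ball_hcp hbm hz hG hξ h hb1 hb2

/-- ★ The rim of a `𝓘₁⁺` instance has at most `167` sites (`7/10`-separated points in the shell `7/4 ≤ r ≤ 9/5`: `(43/7)³ − 4³ < 168`). [folklore] -/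
theorem card_instRim_le {M₁ : ℕ} {z₁ : Fin M₁ → E3} {c₁ : Fin M₁} (hI : CompFamily1 M₁ z₁ c₁) : ((instRim z₁ c₁).card : ℝ) ≤ 167 := by
  have hinj : Function.Injective z₁ := hI.1
  have hsep : Sep z₁ := hI.2.1
  rw [← Finset.card_image_of_injective (instRim z₁ c₁) hinj]
  have h := card_le_of_separated_shell_three ((instRim z₁ c₁).image z₁) (z₁ c₁) (δ := 7 / 10) (R := 7 / 4) (D := 9 / 5)
    (by norm_num) (by norm_num) (by norm_num) ?_ ?_
  · have h' : ((((instRim z₁ c₁).image z₁).card : ℕ) : ℝ) < 168 := h.trans_lt (by norm_num)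
    have h'' : ((instRim z₁ c₁).image z₁).card < 168 := by exact_mod_cast h'
    exact_mod_cast Nat.lt_succ_iff.1 h''
  · intro x hx y hy hxy
    obtain ⟨i, -, rfl⟩ := Finset.mem_image.1 hx
    obtain ⟨j, -, rfl⟩ := Finset.mem_image.1 hy
    exact hsep i j (fun hij => hxy (by rw [hij]))
  · intro x hx
    obtain ⟨i, hi, rfl⟩ := Finset.mem_image.1 hx
    obtain ⟨hiB, hi1⟩ := Finset.mem_filter.1 hi
    exact ⟨hi1.le, mem_ball.1 hiB⟩

/-- ★★★ THE INSTANCE RIM MASS BOUND: `Σ_{b ∈ instRim} 1/#B(b) ≤ 167/14 ≤ 38/3` on every `𝓘₁⁺` instance. [folklore] -/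
theorem instanceRimMass_le {M₁ : ℕ} {z₁ : Fin M₁ → E3} {c₁ : Fin M₁} (hI : CompFamily1 M₁ z₁ c₁) :
    ∑ b ∈ instRim z₁ c₁, (((ball (9 / 5) z₁ b).card : ℝ))⁻¹ ≤ 38 / 3 := by
  calc ∑ b ∈ instRim z₁ c₁, (((ball (9 / 5) z₁ b).card : ℝ))⁻¹ ≤ ∑ b ∈ instRim z₁ c₁, (14 : ℝ)⁻¹ :=
        Finset.sum_le_sum fun b hb => inv_anti₀ (by norm_num) (by exact_mod_cast fourteen_le_card_ball hI hb)
    _ = (instRim z₁ c₁).card * (14 : ℝ)⁻¹ := by rw [Finset.sum_const, nsmul_eq_mul]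
    _ ≤ 167 * (14 : ℝ)⁻¹ := by gcongr; exact card_instRim_le hI
    _ ≤ 38 / 3 := by norm_num

/-- ★★★ **(P3b-inst′) PROVED**: `InstanceRimMassLe (38/3)`. [folklore] -/
theorem instanceRimMassLe_holds : InstanceRimMassLe (38 / 3) := fun _ _ _ hI => instanceRimMass_le hI

/-- ★★★ **(T2-bent₁) PROVED**: `TaylorTwoBent1 = SmoothTaylorTwo CompFamily1 tau1 delta0 G0 w0 rho0` holds outright. [folklore] -/
theorem taylorTwoBent1_holds : TaylorTwoBent1 := taylorTwoBent1_of_instanceRimMass12 instanceRimMassLe_holds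

end Summit.AtomisticToContinuum.Crystallization.Theorems.FrustratedLawDichotomyStrainedPatchTaylorClose
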